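import Summits.QuantumFields.YangMills.Theorems.UnitScaleTiltProp7ChainPotentialHessianFamily
import Summits.QuantumFields.YangMills.Theorems.UnitScaleTiltProp7OneFormGradientSupAllMembers
import HarnessLib

/-!
# Route `UnitScaleTilt`, crux K1 «MinimiserStabilityRegPr» (stmt-QuantumFields-19200), EX face, norm_G road rows (5)∕(6) — **THE ROOM-FREE EDITIONS**
# of HESS-T1 (✓`Prop7GaugeModeHessianRow` §2–§4), of the (H∇)-KNIT (✓`Prop7ChainPotentialHessianRow` §2–§3) and of the (H∇)-FAMILY ∃-package
# (✓`Prop7ChainPotentialHessianFamily.hessRow_chain_family`): the no-wrap antecedent `hroom : 2(12·L^{K−n}+5) ≤ sitesPerDir 0` DELETED everywhere, SAME constants.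

WHY IT IS FREE NOW.  px5 g15's ROOM-ROOT LOCATE (bus 13:55:35Z): the room entered these rows only through T1-core (px19 ✓`Prop7MassiveSolutionGradientSup.norm_equiv_DL2_le_of_sup`,
read at ✓`GaugeModeHessianRow` :136) and through px5 g13's (OF-GRAD) ✓`Prop7OneFormGradientSup.norm_covGradT_le_of_letters` (:193) — both re-typed WITHOUT the room by px5 g15
over the `L³`-fold cover: (R3) ✓`Prop7MassiveSolutionGradientSupAllMembers.norm_equiv_DL2_le_of_sup_allMembers`, (R4) ✓`Prop7OneFormGradientSupAllMembers.norm_covGradT_le_of_letters_allMembers`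
(same binders minus `hroom`, same constants).  This file is the one-token-per-call-site re-run of my lineage's three storeys over those roots (generator `gen/gen_allmembers.py`:
each theorem sliced VERBATIM from the tree, renamed `X ↦ X_allMembers`, its ONE `(hroom : …)` binder deleted, the supplier token swapped), plus the family package re-assembled
without the ROOM line:
* §1 HESS-T1: `norm_toL2_symm_DL2_le_of_lapSup_allMembers` (R3 §2 at `q := −Δ^ηψ`), ★★★`norm_covGradT_DL2_le_of_letters_allMembers`, ★★★`norm_covGradT_DL2_le_DeltaEtaSlot_allMembers`, `norm_covGradT_DL2_le_DeltaPiSlotP_allMembers`;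
* §2 (H∇): ★★`norm_covGradT_DL2_chain_le_of_letters_allMembers`, ★★★`hessRow_chain_of_letters_allMembers` (= the (∇1)-KNIT's `hHD` letter from (c1)(c3)(Dg), NO room);
* §3 ★★★`hessRow_chain_family_allMembers : ∃ (αH′ BH : ℕ → ℝ), … ∀ L > 1, ∀ i U₀ ρ, RegPr ρ U₀ → ρ ≤ αH′ L → Lift → ∀ a′ ≥ 0, ⟨hHD at BH L⟩` — ✓`hessRow_chain_family` WITHOUT the
  `2·(12·L^{K−n}+5) ≤ sitesPerDir 0` antecedent (letters (c1)(c3) ⟸ ✓`hc1_hc3_sup_family`, (Dg) ⟸ ✓`gradRow_RS_GprimeP_allMembers_exists`, both already room-free).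
The room-free helper identities (§1 of ✓`GaugeModeHessianRow`, §1 of ✓`ChainPotentialHessianRow`, ✓`ChainPotentialHessianFamily` §1–§2) are IMPORTED, not copied.

px17 g12 (prover-ym3-torus-px17-g12-0).  Def-free; no `sorry`; 0 `maxHeartbeats` overrides.  HONEST: re-runs of landed proofs over px5 g15's room-free roots; nothing of
STOREY H (`h3`), `h88`, EX, 19200 proved; no summit is proved by a helper; rung R3 = SU(2) YM₃ on T³ — NOT d = 4, NOT infinite volume, NOT a mass gap, NOT Clay.
-/

set_option autoImplicit false

noncomputable section

open scoped BigOperators Matrix.Norms.L2Operator InnerProductSpace ComplexConjugate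

namespace Summit.QuantumFields.YangMills.Theorems.Prop7ChainPotentialHessianAllMembers

open Literature.MathematicalPhysics.QuantumFieldTheory.Balaban1983to89
open Literature.MathematicalPhysics.QuantumFieldTheory.Balaban1983to89.T3ContinuumYM3Torus
open Literature.MathematicalPhysics.QuantumFieldTheory.Balaban1983to89.T3PrintedRegularMinimiser (RegPr)
open Literature.MathematicalPhysics.QuantumFieldTheory.Balaban1983to89.T3PrintedMinimiserExistence (regPr_mono)
open T3SectALandauChart (covGradT bgUnits eta eta_pos)
open B4Sect5Torus (TSite)
open B9SectCLatticeCarrier (Bond)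
open B9Eq311L2Pairing (WL2)
open B11Eq103H1Complex (SiteL2K BondL2K)
open Summit.QuantumFields.YangMills.Theorems.Prop7SectET3Transport (periodsT3 siteEquiv bondEquiv bgOfCfg)
open Summit.QuantumFields.YangMills.Theorems.Prop7SectET3HilbertLetters (W₂ frobEquiv toL2 toL2S QL2 DL2 DstarL2 covLapSite toL2_symm_apply toL2S_symm_apply)
open Summit.QuantumFields.YangMills.Theorems.Prop7SectET3WilsonHessian (DeltaEta DeltaEtaSlot)
open Summit.QuantumFields.YangMills.Theorems.Prop7SectET3GaugeProjector (NS RS QL2_DL2_eq_zero_of_mem_NS RS_apply_covLapSite_of_mem RS_RS)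
open Summit.QuantumFields.YangMills.Theorems.Prop7SectET3CurvedPropagators (Qk laplaceA laplaceA_apply)
open Summit.QuantumFields.YangMills.Theorems.Prop7SectET3DeltaPiPInv (DeltaPiSlotP DeltaPiSlotP_kills_NS GprimeP)
open Summit.QuantumFields.YangMills.Theorems.Prop7RieszTauFrobNorm (norm_frobEquiv_le norm_le_sqrt_two_mul_norm_frobEquiv)
open Summit.QuantumFields.YangMills.Theorems.Prop7OneFormGradientSupAllMembers (norm_covGradT_le_of_letters_allMembers)
open Summit.QuantumFields.YangMills.Theorems.Prop7MassiveSolutionGradientSupAllMembers (norm_equiv_DL2_le_of_sup_allMembers)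
open Summit.QuantumFields.YangMills.Theorems.Prop7CurvedMemberLocalGradient (exists_curved_localGradient)
open Summit.QuantumFields.YangMills.Theorems.AxialGaugeChartGlue (norm_bgOfCfg_axialT_sub_le)
open B11Eq111FrakG (nabla115)
open Summit.QuantumFields.YangMills.Theorems.Prop7OneFormGradientSupNabla (nabla115_bgOfCfg_eq_covGradT)
open Summit.QuantumFields.YangMills.Theorems.Prop7GreenOnPureGaugeSources (GprimeP_RS_mem_NS covLapSite_GprimeP_RS)
open Summit.QuantumFields.YangMills.Theorems.Prop7CurrentPairingPointwise (norm_symm_DeltaEta_DL2_toL2S_apply_le_of_sup)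
open Summit.QuantumFields.YangMills.Theorems.Prop7GaugeModeHessianRow (laplaceA_toL2_symm_DL2_eq DL2_sub_RS_DstarL2_DL2_eq_zero adjoint_Qk_smul_Qk_DL2_eq_zero)
open Summit.QuantumFields.YangMills.Theorems.Prop7ChainPotentialHessianRow (norm_equiv_le_sqrt_two_of_route_sup)
open Summit.QuantumFields.YangMills.Theorems.Prop7ChainPotentialHessianFamily (alphaH_pos alphaH_windows hc1_hc3_sup_family)
open Summit.QuantumFields.YangMills.Theorems.Prop7GradientRowOfPcol (gradRow_RS_GprimeP_allMembers_exists)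
open B15DeterminingSets (embIter)
open Summit.QuantumFields.YangMills.Theorems.Prop8Chart (emlIterU)

section HessT1

variable (F : T3Family) {n K : ℕ} (h : n ≤ K) (c₀ cB : ℝ) [Fact (0 < c₀)] [Fact (0 < cB)] (a : ℝ)
  (Δx : GaugeField (F.P K) 0 (Matrix.specialUnitaryGroup (Fin 2) ℂ) → (BondL2K ℂ 3 (periodsT3 F K) c₀ W₂ →ₗ[ℂ] BondL2K ℂ 3 (periodsT3 F K) c₀ W₂))
  (U₀ : GaugeField (F.P K) 0 (Matrix.specialUnitaryGroup (Fin 2) ℂ))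
  {ε₀ : ℝ} (hε₀ : 0 < ε₀) (hε1 : ε₀ ≤ 1) (hreg : RegPr F n K ε₀ U₀)

/-! ## §1 HESS-T1 without the room (✓`GaugeModeHessianRow` §2–§4 over (R3)∕(R4)) -/

include hε₀ hε1 hreg in
/-- (ROOM-FREE EDITION — `hroom` deleted, over px5 g15 (R3)∕(R4); otherwise VERBATIM.) ★★ **T1-core ON THE ROUTE's BONDS**: for ANY site field `ψ` with `‖ψ‖_∞ ≤ M_ψ`, `‖Δ^η_{U₀}ψ‖_∞ ≤ M_φ` (torus currency), under `RegPr`, the margin,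
`‖(toL2⁻¹(D_{U₀}ψ))(b)‖ ≤ 2·(C_g·(M_ψ·c(ε₀) + M_φ) + 2√2·48ε₀·M_ψ)` at EVERY route bond `b` (✓`norm_equiv_DL2_le_of_sup_allMembers` at `u := ψ`, `q := −Δ^ηψ`; `‖frobEquiv v‖ ≤ ‖v‖`).
[cite: Balaban1985BackgroundPropagators, Lemma 3.2 (3.45)–(3.48) pp.398–399, Thm 3.1 (3.42) p.397] -/
theorem norm_toL2_symm_DL2_le_of_lapSup_allMembers (ψ : SiteL2K ℂ 3 (periodsT3 F K) c₀ W₂) {Mψ Mφ : ℝ} (hMψ0 : 0 ≤ Mψ) (hMφ0 : 0 ≤ Mφ)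
    (hMψ : ∀ x : TSite 3 (periodsT3 F K), ‖WL2.equiv ℂ (fun _ : TSite 3 (periodsT3 F K) => c₀) W₂ ψ x‖ ≤ Mψ)
    (hMφ : ∀ x : TSite 3 (periodsT3 F K), ‖WL2.equiv ℂ (fun _ : TSite 3 (periodsT3 F K) => c₀) W₂ (covLapSite F n K c₀ U₀ ψ) x‖ ≤ Mφ)
    (hsmall : exists_curved_localGradient.choose * ((48 * ε₀) * (6 * Real.sqrt 2 * Real.sqrt 10 + 6 * Real.sqrt 2)) ≤ 1 / 2)
    (b : PBond (F.P K) 0) :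
    ‖(toL2 F K c₀).symm (DL2 F n K c₀ U₀ ψ) b‖
      ≤ 2 * (exists_curved_localGradient.choose *
            (Mψ * (2 + 2 * Real.sqrt 2 * (4 * ε₀ * (3 + 2457 * norm_bgOfCfg_axialT_sub_le.choose)) + (24 * Real.sqrt 10 + 48) * (48 * ε₀) ^ 2) + Mφ)
          + 2 * Real.sqrt 2 * (48 * ε₀) * Mψ) := by
  have heq : covLapSite F n K c₀ U₀ ψ + (-covLapSite F n K c₀ U₀ ψ) = DstarL2 F n K c₀ U₀ 0 := by rw [add_neg_cancel, map_zero]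
  have hMq : ∀ x : TSite 3 (periodsT3 F K), ‖WL2.equiv ℂ (fun _ : TSite 3 (periodsT3 F K) => c₀) W₂ (-covLapSite F n K c₀ U₀ ψ) x‖ ≤ Mφ := by
    intro x
    have hx : WL2.equiv ℂ (fun _ : TSite 3 (periodsT3 F K) => c₀) W₂ (-covLapSite F n K c₀ U₀ ψ) x =
        -(WL2.equiv ℂ (fun _ : TSite 3 (periodsT3 F K) => c₀) W₂ (covLapSite F n K c₀ U₀ ψ) x) := rfl
    rw [hx, norm_neg]; exact hMφ x
  rw [toL2_symm_apply]
  exact (norm_frobEquiv_le _).trans (norm_equiv_DL2_le_of_sup_allMembers F n K hε₀ hε1 U₀ hreg c₀ _ _ heq hMψ0 hMφ0 hMψ hMq hsmall _)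

include hε₀ hε1 hreg in
/-- (ROOM-FREE EDITION — `hroom` deleted, over px5 g15 (R3)∕(R4); otherwise VERBATIM.) ★★★ **THE HESSIAN ROW OF `(Δ₀|_{N_S})⁻¹` (N6 item 6 «HESS-T1»).**  For `ψ ∈ N_S(U₀)` at a printed-regular background, ANY Hessian slot `Δx`, with the global sup letters
`‖ψ‖_∞ ≤ M_ψ`, `‖Δ^ηψ‖_∞ ≤ M_φ`, the source-gradient letter `‖(toL2⁻¹(D(Δ^ηψ)))(b)‖ ≤ G_φ`, the gauge-mode letters `‖(toL2⁻¹(Δx(Dψ)))(b)‖ ≤ M_C`, `‖(toL2⁻¹(Δ^η(Dψ)))(b)‖ ≤ M_E`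
((C-val) = (3.117) current pairing), the margin: EVERY second covariant derivative of `ψ` is bounded,
`‖covGradT η (bgUnits U₀) (toL2⁻¹(Dψ)) μ ν x‖ ≤ (OF-GRAD)'s bound at `s := T₁(M_ψ, M_φ)`, `M_Y := M_C + G_φ`, `M_X := M_C + M_E`, `M_D := 0`, `M_Q := 0`.
[cite: Balaban1985BackgroundPropagators, Thm 3.1 (3.42)–(3.45) pp.397–398, (3.115)–(3.117) pp.418–419, p.423; Balaban1985Variational, (19) p.281, (134)–(135) p.298] -/
theorem norm_covGradT_DL2_le_of_letters_allMembers {ψ : SiteL2K ℂ 3 (periodsT3 F K) c₀ W₂} (hψ : ψ ∈ NS F n K h c₀ cB U₀)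
    {Mψ Mφ Gφ MC ME : ℝ} (hMψ0 : 0 ≤ Mψ) (hMφ0 : 0 ≤ Mφ) (hGφ0 : 0 ≤ Gφ) (hMC0 : 0 ≤ MC) (hME0 : 0 ≤ ME)
    (hMψ : ∀ x : TSite 3 (periodsT3 F K), ‖WL2.equiv ℂ (fun _ : TSite 3 (periodsT3 F K) => c₀) W₂ ψ x‖ ≤ Mψ)
    (hMφ : ∀ x : TSite 3 (periodsT3 F K), ‖WL2.equiv ℂ (fun _ : TSite 3 (periodsT3 F K) => c₀) W₂ (covLapSite F n K c₀ U₀ ψ) x‖ ≤ Mφ)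
    (hGφ : ∀ b : PBond (F.P K) 0, ‖(toL2 F K c₀).symm (DL2 F n K c₀ U₀ (covLapSite F n K c₀ U₀ ψ)) b‖ ≤ Gφ)
    (hMC : ∀ b : PBond (F.P K) 0, ‖(toL2 F K c₀).symm (Δx U₀ (DL2 F n K c₀ U₀ ψ)) b‖ ≤ MC)
    (hME : ∀ b : PBond (F.P K) 0, ‖(toL2 F K c₀).symm ((DeltaEta F n K c₀ U₀ : BondL2K ℂ 3 (periodsT3 F K) c₀ W₂ →ₗ[ℂ] BondL2K ℂ 3 (periodsT3 F K) c₀ W₂) (DL2 F n K c₀ U₀ ψ)) b‖ ≤ ME)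
    (hsmall : exists_curved_localGradient.choose * ((48 * ε₀) * (6 * Real.sqrt 2 * Real.sqrt 10 + 6 * Real.sqrt 2)) ≤ 1 / 2)
    (μ ν : Fin (F.P K).d) (x : Site (F.P K) 0) :
    ‖covGradT (eta F n K) (bgUnits F K U₀) ((toL2 F K c₀).symm (DL2 F n K c₀ U₀ ψ)) μ ν x‖
      ≤ 2 * (exists_curved_localGradient.choose * ((Real.sqrt 2 * (2 * (exists_curved_localGradient.choose * (Mψ * (2 + 2 * Real.sqrt 2 * (4 * ε₀ * (3 + 2457 * norm_bgOfCfg_axialT_sub_le.choose)) + (24 * Real.sqrt 10 + 48) * (48 * ε₀) ^ 2) + Mφ) + 2 * Real.sqrt 2 * (48 * ε₀) * Mψ))) * (2 + 2 * Real.sqrt 2 * (4 * ε₀ * (3 + 2457 * norm_bgOfCfg_axialT_sub_le.choose)) + (24 * Real.sqrt 10 + 48) * (48 * ε₀) ^ 2) + (Real.sqrt 2 * (32 * ε₀ * (2 * (exists_curved_localGradient.choose * (Mψ * (2 + 2 * Real.sqrt 2 * (4 * ε₀ * (3 + 2457 * norm_bgOfCfg_axialT_sub_le.choose)) + (24 *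 Real.sqrt 10 + 48) * (48 * ε₀) ^ 2) + Mφ) + 2 * Real.sqrt 2 * (48 * ε₀) * Mψ)) + (MC + ME) + 0 + 0 + (MC + Gφ)))) + 2 * Real.sqrt 2 * (48 * ε₀) * (Real.sqrt 2 * (2 * (exists_curved_localGradient.choose * (Mψ * (2 + 2 * Real.sqrt 2 * (4 * ε₀ * (3 + 2457 * norm_bgOfCfg_axialT_sub_le.choose)) + (24 * Real.sqrt 10 + 48) * (48 * ε₀) ^ 2) + Mφ) + 2 * Real.sqrt 2 * (48 * ε₀) * Mψ)))) := by
  -- the one-form and its source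
  set X : (PBond (F.P K) 0 → Matrix (Fin 2) (Fin 2) ℂ) := (toL2 F K c₀).symm (DL2 F n K c₀ U₀ ψ) with hXdef
  set Y : (PBond (F.P K) 0 → Matrix (Fin 2) (Fin 2) ℂ) :=
    (toL2 F K c₀).symm (Δx U₀ (DL2 F n K c₀ U₀ ψ) + DL2 F n K c₀ U₀ (covLapSite F n K c₀ U₀ ψ)) with hYdef
  -- the coupling of the auxiliary one-form operator is immaterial on a gauge mode; take `0`
  have hXY : laplaceA F n K h c₀ cB 0 Δx U₀ (toL2 F K c₀ X) = toL2 F K c₀ Y := laplaceA_toL2_symm_DL2_eq F h c₀ cB 0 Δx U₀ hψ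
  have htoX : toL2 F K c₀ X = DL2 F n K c₀ U₀ ψ := LinearEquiv.apply_symm_apply _ _
  -- the component sup from T1-core
  set s : ℝ := 2 * (exists_curved_localGradient.choose *
      (Mψ * (2 + 2 * Real.sqrt 2 * (4 * ε₀ * (3 + 2457 * norm_bgOfCfg_axialT_sub_le.choose)) + (24 * Real.sqrt 10 + 48) * (48 * ε₀) ^ 2) + Mφ)
    + 2 * Real.sqrt 2 * (48 * ε₀) * Mψ) with hsdef
  have hX : ∀ b, ‖X b‖ ≤ s := fun b => norm_toL2_symm_DL2_le_of_lapSup_allMembers F c₀ U₀ hε₀ hε1 hreg ψ hMψ0 hMφ0 hMψ hMφ hsmall b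
  have hCg0 : 0 ≤ exists_curved_localGradient.choose := exists_curved_localGradient.choose_spec.1
  obtain ⟨hC0, -⟩ := norm_bgOfCfg_axialT_sub_le.choose_spec
  have hs : 0 ≤ s := by positivity
  -- the source letter
  have hY : ∀ b, ‖Y b‖ ≤ MC + Gφ := by
    intro b
    rw [hYdef, map_add, Pi.add_apply]
    exact (norm_add_le _ _).trans (add_le_add (hMC b) (hGφ b))
  -- the slot letter
  have hXs : ∀ b : PBond (F.P K) 0, ‖(toL2 F K c₀).symm ((Δx U₀ - (DeltaEta F n K c₀ U₀ : BondL2K ℂ 3 (periodsT3 F K) c₀ W₂ →ₗ[ℂ] BondL2K ℂ 3 (periodsT3 F K) c₀ W₂))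
      (toL2 F K c₀ X)) b‖ ≤ MC + ME := by
    intro b
    rw [htoX, LinearMap.sub_apply, map_sub, Pi.sub_apply]
    exact (norm_sub_le _ _).trans (add_le_add (hMC b) (hME b))
  -- (D) and (Q) vanish
  have hD : ∀ b : PBond (F.P K) 0, ‖(toL2 F K c₀).symm (DL2 F n K c₀ U₀ (DstarL2 F n K c₀ U₀ (toL2 F K c₀ X)
      - RS F n K h c₀ cB U₀ (DstarL2 F n K c₀ U₀ (toL2 F K c₀ X)))) b‖ ≤ 0 := by
    intro b
    rw [htoX, DL2_sub_RS_DstarL2_DL2_eq_zero F h c₀ cB U₀ hψ, map_zero, Pi.zero_apply, norm_zero]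
  have hQ : ∀ b : PBond (F.P K) 0, ‖(toL2 F K c₀).symm (LinearMap.adjoint (Qk F n K h c₀ cB U₀)
      ((((0 : ℝ) : ℝ) : ℂ) • Qk F n K h c₀ cB U₀ (toL2 F K c₀ X))) b‖ ≤ 0 := by
    intro b
    rw [htoX, adjoint_Qk_smul_Qk_DL2_eq_zero F h c₀ cB 0 U₀ hψ, map_zero, Pi.zero_apply, norm_zero]
  exact norm_covGradT_le_of_letters_allMembers F h c₀ cB 0 Δx U₀ hε₀ hε1 hreg X Y hXY hs (add_nonneg hMC0 hGφ0) (add_nonneg hMC0 hME0) le_rfl le_rfl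
    hX hY hXs hD hQ hsmall μ ν x

include hε₀ hε1 hreg in
/-- (ROOM-FREE EDITION — `hroom` deleted, over px5 g15 (R3)∕(R4); otherwise VERBATIM.) ★★★ **THE HESSIAN ROW AT THE SLOT OF RECORD `G₀` (`Δx := DeltaEtaSlot`): ONE gauge-mode letter `M_E`** (`M_C := M_E`, since `DeltaEtaSlot U₀ = Δ^η(U₀)` by `rfl`).
[cite: Balaban1985BackgroundPropagators, (3.26)–(3.27) p.395, (3.117) p.419, Thm 3.1 (3.42)–(3.45) pp.397–398] -/
theorem norm_covGradT_DL2_le_DeltaEtaSlot_allMembers {ψ : SiteL2K ℂ 3 (periodsT3 F K) c₀ W₂} (hψ : ψ ∈ NS F n K h c₀ cB U₀)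
    {Mψ Mφ Gφ ME : ℝ} (hMψ0 : 0 ≤ Mψ) (hMφ0 : 0 ≤ Mφ) (hGφ0 : 0 ≤ Gφ) (hME0 : 0 ≤ ME)
    (hMψ : ∀ x : TSite 3 (periodsT3 F K), ‖WL2.equiv ℂ (fun _ : TSite 3 (periodsT3 F K) => c₀) W₂ ψ x‖ ≤ Mψ)
    (hMφ : ∀ x : TSite 3 (periodsT3 F K), ‖WL2.equiv ℂ (fun _ : TSite 3 (periodsT3 F K) => c₀) W₂ (covLapSite F n K c₀ U₀ ψ) x‖ ≤ Mφ)
    (hGφ : ∀ b : PBond (F.P K) 0, ‖(toL2 F K c₀).symm (DL2 F n K c₀ U₀ (covLapSite F n K c₀ U₀ ψ)) b‖ ≤ Gφ)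
    (hME : ∀ b : PBond (F.P K) 0, ‖(toL2 F K c₀).symm ((DeltaEta F n K c₀ U₀ : BondL2K ℂ 3 (periodsT3 F K) c₀ W₂ →ₗ[ℂ] BondL2K ℂ 3 (periodsT3 F K) c₀ W₂) (DL2 F n K c₀ U₀ ψ)) b‖ ≤ ME)
    (hsmall : exists_curved_localGradient.choose * ((48 * ε₀) * (6 * Real.sqrt 2 * Real.sqrt 10 + 6 * Real.sqrt 2)) ≤ 1 / 2)
    (μ ν : Fin (F.P K).d) (x : Site (F.P K) 0) :
    ‖covGradT (eta F n K) (bgUnits F K U₀) ((toL2 F K c₀).symm (DL2 F n K c₀ U₀ ψ)) μ ν x‖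
      ≤ 2 * (exists_curved_localGradient.choose * ((Real.sqrt 2 * (2 * (exists_curved_localGradient.choose * (Mψ * (2 + 2 * Real.sqrt 2 * (4 * ε₀ * (3 + 2457 * norm_bgOfCfg_axialT_sub_le.choose)) + (24 * Real.sqrt 10 + 48) * (48 * ε₀) ^ 2) + Mφ) + 2 * Real.sqrt 2 * (48 * ε₀) * Mψ))) * (2 + 2 * Real.sqrt 2 * (4 * ε₀ * (3 + 2457 * norm_bgOfCfg_axialT_sub_le.choose)) + (24 * Real.sqrt 10 + 48) * (48 * ε₀) ^ 2) + (Real.sqrt 2 * (32 * ε₀ * (2 * (exists_curved_localGradient.choose * (Mψ * (2 + 2 * Real.sqrt 2 * (4 * ε₀ * (3 + 2457 * norm_bgOfCfg_axialT_sub_le.choose)) + (24 * Real.sqrt 10 + 48) * (48 * ε₀) ^ 2) + Mφ) + 2 * Real.sqrt 2 * (48 * ε₀) * Mψ)) + (ME + ME) + 0 + 0 + (ME + Gφ)))) + 2 * Real.sqrt 2 * (48 * ε₀) * (Real.sqrt 2 * (2 * (exists_curved_localGradient.choose * (Mψ * (2 + 2 * Real.sqrt 2 * (4 * ε₀ * (3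 + 2457 * norm_bgOfCfg_axialT_sub_le.choose)) + (24 * Real.sqrt 10 + 48) * (48 * ε₀) ^ 2) + Mφ) + 2 * Real.sqrt 2 * (48 * ε₀) * Mψ)))) := by
  have hMC : ∀ b : PBond (F.P K) 0, ‖(toL2 F K c₀).symm (DeltaEtaSlot F n K c₀ U₀ (DL2 F n K c₀ U₀ ψ)) b‖ ≤ ME := fun b => hME b
  exact norm_covGradT_DL2_le_of_letters_allMembers F h c₀ cB (DeltaEtaSlot F n K c₀) U₀ hε₀ hε1 hreg hψ hMψ0 hMφ0 hGφ0 hME0 hME0 hMψ hMφ hGφ hMC hME hsmall μ ν x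

include hε₀ hε1 hreg in
/-- (ROOM-FREE EDITION — `hroom` deleted, over px5 g15 (R3)∕(R4); otherwise VERBATIM.) ★★★ **THE HESSIAN ROW AT THE Π-SLOT (`Δx := DeltaPiSlotP`, `0 ≤ a`): `M_C := 0`** — `Δ_πᴾ(U₀)` KILLS `D_{U₀}N_S` (✓`DeltaPiSlotP_kills_NS`), so only the (3.117) letter `M_E` is displayed.
[cite: Balaban1985BackgroundPropagators, (3.119) p.419, (3.122) p.420, (3.117) p.419, Thm 3.1 (3.42)–(3.45) pp.397–398] -/
theorem norm_covGradT_DL2_le_DeltaPiSlotP_allMembers (ha : 0 ≤ a) {ψ : SiteL2K ℂ 3 (periodsT3 F K) c₀ W₂} (hψ : ψ ∈ NS F n K h c₀ cB U₀)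
    {Mψ Mφ Gφ ME : ℝ} (hMψ0 : 0 ≤ Mψ) (hMφ0 : 0 ≤ Mφ) (hGφ0 : 0 ≤ Gφ) (hME0 : 0 ≤ ME)
    (hMψ : ∀ x : TSite 3 (periodsT3 F K), ‖WL2.equiv ℂ (fun _ : TSite 3 (periodsT3 F K) => c₀) W₂ ψ x‖ ≤ Mψ)
    (hMφ : ∀ x : TSite 3 (periodsT3 F K), ‖WL2.equiv ℂ (fun _ : TSite 3 (periodsT3 F K) => c₀) W₂ (covLapSite F n K c₀ U₀ ψ) x‖ ≤ Mφ)
    (hGφ : ∀ b : PBond (F.P K) 0, ‖(toL2 F K c₀).symm (DL2 F n K c₀ U₀ (covLapSite F n K c₀ U₀ ψ)) b‖ ≤ Gφ)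
    (hME : ∀ b : PBond (F.P K) 0, ‖(toL2 F K c₀).symm ((DeltaEta F n K c₀ U₀ : BondL2K ℂ 3 (periodsT3 F K) c₀ W₂ →ₗ[ℂ] BondL2K ℂ 3 (periodsT3 F K) c₀ W₂) (DL2 F n K c₀ U₀ ψ)) b‖ ≤ ME)
    (hsmall : exists_curved_localGradient.choose * ((48 * ε₀) * (6 * Real.sqrt 2 * Real.sqrt 10 + 6 * Real.sqrt 2)) ≤ 1 / 2)
    (μ ν : Fin (F.P K).d) (x : Site (F.P K) 0) :
    ‖covGradT (eta F n K) (bgUnits F K U₀) ((toL2 F K c₀).symm (DL2 F n K c₀ U₀ ψ)) μ ν x‖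
      ≤ 2 * (exists_curved_localGradient.choose * ((Real.sqrt 2 * (2 * (exists_curved_localGradient.choose * (Mψ * (2 + 2 * Real.sqrt 2 * (4 * ε₀ * (3 + 2457 * norm_bgOfCfg_axialT_sub_le.choose)) + (24 * Real.sqrt 10 + 48) * (48 * ε₀) ^ 2) + Mφ) + 2 * Real.sqrt 2 * (48 * ε₀) * Mψ))) * (2 + 2 * Real.sqrt 2 * (4 * ε₀ * (3 + 2457 * norm_bgOfCfg_axialT_sub_le.choose)) + (24 * Real.sqrt 10 + 48) * (48 * ε₀) ^ 2) + (Real.sqrt 2 * (32 * ε₀ * (2 * (exists_curved_localGradient.choose * (Mψ * (2 + 2 * Real.sqrt 2 * (4 * ε₀ * (3 + 2457 * norm_bgOfCfg_axialT_sub_le.choose)) + (24 * Real.sqrt 10 + 48) * (48 * ε₀) ^ 2) + Mφ) + 2 * Real.sqrt 2 * (48 * ε₀) * Mψ)) + (0 + ME) + 0 + 0 + (0 + Gφ)))) + 2 * Real.sqrt 2 * (48 * ε₀) * (Real.sqrt 2 * (2 * (exists_curved_localGradient.choose * (Mψ * (2 + 2 * Real.sqrt 2 * (4 * ε₀ * (3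 + 2457 * norm_bgOfCfg_axialT_sub_le.choose)) + (24 * Real.sqrt 10 + 48) * (48 * ε₀) ^ 2) + Mφ) + 2 * Real.sqrt 2 * (48 * ε₀) * Mψ)))) := by
  have hMC : ∀ b : PBond (F.P K) 0, ‖(toL2 F K c₀).symm (DeltaPiSlotP F n K h c₀ cB a U₀ (DL2 F n K c₀ U₀ ψ)) b‖ ≤ 0 := fun b => by
    rw [DeltaPiSlotP_kills_NS ha ψ hψ, map_zero, Pi.zero_apply, norm_zero]
  exact norm_covGradT_DL2_le_of_letters_allMembers F h c₀ cB (DeltaPiSlotP F n K h c₀ cB a) U₀ hε₀ hε1 hreg hψ hMψ0 hMφ0 hGφ0 le_rfl hME0 hMψ hMφ hGφ hMC hME hsmall μ ν x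

end HessT1

section Chain

variable (F : T3Family) {n K : ℕ} (h : n ≤ K) (c₀ cB : ℝ) [Fact (0 < c₀)] [Fact (0 < cB)] (a : ℝ)

/-! ## §2 The (H∇)-KNIT without the room (✓`ChainPotentialHessianRow` §2–§3 over §1) -/

/-- (ROOM-FREE EDITION — `hroom` deleted, over px5 g15 (R3)∕(R4); otherwise VERBATIM.) ★★ **EVERY SECOND COVARIANT DERIVATIVE OF THE CHAIN POTENTIAL `ψ = G′ᴾR_SG′ᴾ(toL2S v)` IS BOUNDED BY `‖v‖_∞`** — HESS-T1 ✓`norm_covGradT_DL2_le_DeltaEtaSlot_allMembers` at `ψ ∈ N_S`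
(✓`GprimeP_RS_mem_NS`), `Δ^ηψ = R_SG′ᴾ(toL2S v)` (✓`covLapSite_GprimeP_RS`), with `M_ψ := √2·C₁·(C₃·m)` ((c3), `R_SR_S = R_S`, (c1), §1), `M_φ := √2·(C₃·m)` ((c3), §1), `G_φ := C_Dg·m` ((Dg)),
`M_E := 4α·(C₁·(C₃·m))` ((C-val)).  [cite: Balaban1985BackgroundPropagators, (3.21)–(3.25) p.394, (3.115)–(3.117) pp.418–419, Thm 3.1 (3.42)–(3.45) pp.397–398; Balaban1985Variational, (19) p.281] -/
theorem norm_covGradT_DL2_chain_le_of_letters_allMembers {α : ℝ} (hα0 : 0 < α) (hα1 : α ≤ 1) (U₀ : GaugeField (F.P K) 0 (Matrix.specialUnitaryGroup (Fin 2) ℂ)) (hreg : RegPr F n K α U₀)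
    (ha : 0 ≤ a) {C₁ C₃ CDg : ℝ} (hC₁ : 0 ≤ C₁) (hC₃ : 0 ≤ C₃) (hCDg : 0 ≤ CDg)
    (hc1 : ∀ (v : Site (F.P K) 0 → Matrix (Fin 2) (Fin 2) ℂ) (m : ℝ), (∀ x, ‖v x‖ ≤ m) →
      ∀ x, ‖(toL2S F K c₀).symm (GprimeP F n K h c₀ cB a U₀ (RS F n K h c₀ cB U₀ (toL2S F K c₀ v))) x‖ ≤ C₁ * m)
    (hc3 : ∀ (v : Site (F.P K) 0 → Matrix (Fin 2) (Fin 2) ℂ) (m : ℝ), (∀ x, ‖v x‖ ≤ m) →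
      ∀ x, ‖(toL2S F K c₀).symm (RS F n K h c₀ cB U₀ (GprimeP F n K h c₀ cB a U₀ (toL2S F K c₀ v))) x‖ ≤ C₃ * m)
    (hDg : ∀ (v : Site (F.P K) 0 → Matrix (Fin 2) (Fin 2) ℂ) (m : ℝ), (∀ x, ‖v x‖ ≤ m) →
      ∀ b, ‖(toL2 F K c₀).symm (DL2 F n K c₀ U₀ (RS F n K h c₀ cB U₀ (GprimeP F n K h c₀ cB a U₀ (toL2S F K c₀ v)))) b‖ ≤ CDg * m)
    (hsmall : exists_curved_localGradient.choose * ((48 * α) * (6 * Real.sqrt 2 * Real.sqrt 10 + 6 * Real.sqrt 2)) ≤ 1 / 2)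
    (v : Site (F.P K) 0 → Matrix (Fin 2) (Fin 2) ℂ) {m : ℝ} (hv : ∀ x, ‖v x‖ ≤ m)
    (μ ν : Fin (F.P K).d) (x : Site (F.P K) 0) :
    ‖covGradT (eta F n K) (bgUnits F K U₀)
        ((toL2 F K c₀).symm (DL2 F n K c₀ U₀ (GprimeP F n K h c₀ cB a U₀ (RS F n K h c₀ cB U₀ (GprimeP F n K h c₀ cB a U₀ (toL2S F K c₀ v)))))) μ ν x‖
      ≤ 2 * (exists_curved_localGradient.choose * ((Real.sqrt 2 * (2 * (exists_curved_localGradient.choose * ((Real.sqrt 2 * (C₁ * (C₃ * m))) * (2 + 2 * Real.sqrt 2 * (4 * α * (3 + 2457 * norm_bgOfCfg_axialT_sub_le.choose)) + (24 * Real.sqrt 10 + 48) * (48 * α) ^ 2) + (Real.sqrt 2 * (C₃ * m))) + 2 * Real.sqrt 2 * (48 * α) * (Real.sqrt 2 * (C₁ * (C₃ * m)))))) * (2 + 2 * Real.sqrt 2 * (4 * α * (3 + 2457 * norm_bgOfCfg_axialT_sub_le.choose)) + (24 * Real.sqrt 10 + 48) * (48 * α) ^ 2) + (Real.sqrt 2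 * (32 * α * (2 * (exists_curved_localGradient.choose * ((Real.sqrt 2 * (C₁ * (C₃ * m))) * (2 + 2 * Real.sqrt 2 * (4 * α * (3 + 2457 * norm_bgOfCfg_axialT_sub_le.choose)) + (24 * Real.sqrt 10 + 48) * (48 * α) ^ 2) + (Real.sqrt 2 * (C₃ * m))) + 2 * Real.sqrt 2 * (48 * α) * (Real.sqrt 2 * (C₁ * (C₃ * m))))) + ((4 * α * (C₁ * (C₃ * m))) + (4 * α * (C₁ * (C₃ * m)))) + 0 + 0 + ((4 * α * (C₁ * (C₃ * m))) + CDg * m)))) + 2 * Real.sqrt 2 * (48 * α) * (Real.sqrt 2 * (2 * (exists_curved_localGradient.choose * ((Real.sqrt 2 * (C₁ * (C₃ * m))) * (2 + 2 * Real.sqrt 2 * (4 * α * (3 + 2457 * norm_bgOfCfg_axialT_sub_le.choose)) + (24 * Real.sqrt 10 + 48) * (48 * α) ^ 2) + (Real.sqrt 2 * (C₃ * m))) + 2 * Real.sqrt 2 * (48 * α) * (Real.sqrt 2 * (C₁ * (C₃ * m))))))) := by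
  -- the objects
  set g : SiteL2K ℂ 3 (periodsT3 F K) c₀ W₂ := GprimeP F n K h c₀ cB a U₀ (toL2S F K c₀ v) with hg
  set ψ : SiteL2K ℂ 3 (periodsT3 F K) c₀ W₂ := GprimeP F n K h c₀ cB a U₀ (RS F n K h c₀ cB U₀ g) with hψ
  have hψNS : ψ ∈ NS F n K h c₀ cB U₀ := GprimeP_RS_mem_NS ha U₀ g
  have hφ : covLapSite F n K c₀ U₀ ψ = RS F n K h c₀ cB U₀ g := covLapSite_GprimeP_RS ha U₀ g
  have hm : 0 ≤ m := (norm_nonneg _).trans (hv (Classical.arbitrary _))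
  -- (c3): the projected source in route sup
  have hGv : ∀ y, ‖(toL2S F K c₀).symm (RS F n K h c₀ cB U₀ g) y‖ ≤ C₃ * m := fun y => hc3 v m hv y
  -- (c1) after `R_SR_S = R_S`: the potential in route sup
  set Gv : Site (F.P K) 0 → Matrix (Fin 2) (Fin 2) ℂ := (toL2S F K c₀).symm (RS F n K h c₀ cB U₀ g) with hGvd
  have hGveq : toL2S F K c₀ Gv = RS F n K h c₀ cB U₀ g := LinearEquiv.apply_symm_apply _ _
  have hψeq : ψ = GprimeP F n K h c₀ cB a U₀ (RS F n K h c₀ cB U₀ (toL2S F K c₀ Gv)) := by rw [hGveq, RS_RS]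
  have hψsup : ∀ y, ‖(toL2S F K c₀).symm ψ y‖ ≤ C₁ * (C₃ * m) := fun y => by rw [hψeq]; exact hc1 Gv _ hGv y
  -- the four HESS-T1 letters
  have hMψ : ∀ z : TSite 3 (periodsT3 F K), ‖WL2.equiv ℂ (fun _ : TSite 3 (periodsT3 F K) => c₀) W₂ ψ z‖ ≤ Real.sqrt 2 * (C₁ * (C₃ * m)) :=
    norm_equiv_le_sqrt_two_of_route_sup F c₀ ψ hψsup
  have hMφ : ∀ z : TSite 3 (periodsT3 F K), ‖WL2.equiv ℂ (fun _ : TSite 3 (periodsT3 F K) => c₀) W₂ (covLapSite F n K c₀ U₀ ψ) z‖ ≤ Real.sqrt 2 * (C₃ * m) := by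
    rw [hφ]; exact norm_equiv_le_sqrt_two_of_route_sup F c₀ _ hGv
  have hGφ : ∀ b : PBond (F.P K) 0, ‖(toL2 F K c₀).symm (DL2 F n K c₀ U₀ (covLapSite F n K c₀ U₀ ψ)) b‖ ≤ CDg * m := by
    intro b; rw [hφ, hg]; exact hDg v m hv b
  have hME : ∀ b : PBond (F.P K) 0, ‖(toL2 F K c₀).symm ((DeltaEta F n K c₀ U₀ : BondL2K ℂ 3 (periodsT3 F K) c₀ W₂ →ₗ[ℂ] BondL2K ℂ 3 (periodsT3 F K) c₀ W₂)
      (DL2 F n K c₀ U₀ ψ)) b‖ ≤ 4 * α * (C₁ * (C₃ * m)) := by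
    intro b
    have e : ψ = toL2S F K c₀ ((toL2S F K c₀).symm ψ) := (LinearEquiv.apply_symm_apply _ _).symm
    rw [e]
    exact norm_symm_DeltaEta_DL2_toL2S_apply_le_of_sup U₀ hreg _ hψsup b
  have h0ψ : 0 ≤ Real.sqrt 2 * (C₁ * (C₃ * m)) := by positivity
  have h0φ : 0 ≤ Real.sqrt 2 * (C₃ * m) := by positivity
  have h0G : 0 ≤ CDg * m := by positivity
  have h0E : 0 ≤ 4 * α * (C₁ * (C₃ * m)) := by have := hα0.le; positivity
  exact norm_covGradT_DL2_le_DeltaEtaSlot_allMembers F h c₀ cB U₀ hα0 hα1 hreg hψNS h0ψ h0φ h0G h0E hMψ hMφ hGφ hME hsmall μ ν x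

/-- (ROOM-FREE EDITION — `hroom` deleted, over px5 g15 (R3)∕(R4); otherwise VERBATIM.) ★★★ **(H∇) = THE (∇1)-KNIT's `hHD` LETTER**: at `RegPr F n K α U₀` (`0 < α ≤ 1`), `0 ≤ a`, from (c1)(c3)(Dg), the room and T1's margin:
`∀ v m, (∀ x, ‖v x‖ ≤ m) → ‖nabla115 ((L⁻¹)^(K−n)) (bgOfCfg F K U₀) (fun q => toL2⁻¹(D_{U₀}(G′ᴾ(R_S(G′ᴾ(toL2S v))))) (bondEquiv⁻¹ q))‖ ≤ BH·m` with `BH` = §2's bound per unit `m`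
(the (115) dictionary ✓`nabla115_bgOfCfg_eq_covGradT`; the Pi sup norm over `Bond × Fin 3`; `η = (L⁻¹)^(K−n)` by `rfl`).
[cite: Balaban1985Variational, (19) p.281, (115)–(117) pp.294–295; Balaban1985BackgroundPropagators, (3.3) p.391, Thm 3.1 (3.42)–(3.45) pp.397–398, (3.138) p.423] -/
theorem hessRow_chain_of_letters_allMembers {α : ℝ} (hα0 : 0 < α) (hα1 : α ≤ 1) (U₀ : GaugeField (F.P K) 0 (Matrix.specialUnitaryGroup (Fin 2) ℂ)) (hreg : RegPr F n K α U₀)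
    (ha : 0 ≤ a) {C₁ C₃ CDg : ℝ} (hC₁ : 0 ≤ C₁) (hC₃ : 0 ≤ C₃) (hCDg : 0 ≤ CDg)
    (hc1 : ∀ (v : Site (F.P K) 0 → Matrix (Fin 2) (Fin 2) ℂ) (m : ℝ), (∀ x, ‖v x‖ ≤ m) →
      ∀ x, ‖(toL2S F K c₀).symm (GprimeP F n K h c₀ cB a U₀ (RS F n K h c₀ cB U₀ (toL2S F K c₀ v))) x‖ ≤ C₁ * m)
    (hc3 : ∀ (v : Site (F.P K) 0 → Matrix (Fin 2) (Fin 2) ℂ) (m : ℝ), (∀ x, ‖v x‖ ≤ m) →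
      ∀ x, ‖(toL2S F K c₀).symm (RS F n K h c₀ cB U₀ (GprimeP F n K h c₀ cB a U₀ (toL2S F K c₀ v))) x‖ ≤ C₃ * m)
    (hDg : ∀ (v : Site (F.P K) 0 → Matrix (Fin 2) (Fin 2) ℂ) (m : ℝ), (∀ x, ‖v x‖ ≤ m) →
      ∀ b, ‖(toL2 F K c₀).symm (DL2 F n K c₀ U₀ (RS F n K h c₀ cB U₀ (GprimeP F n K h c₀ cB a U₀ (toL2S F K c₀ v)))) b‖ ≤ CDg * m)
    (hsmall : exists_curved_localGradient.choose * ((48 * α) * (6 * Real.sqrt 2 * Real.sqrt 10 + 6 * Real.sqrt 2)) ≤ 1 / 2) :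
    ∀ (v : Site (F.P K) 0 → Matrix (Fin 2) (Fin 2) ℂ) (m : ℝ), (∀ x, ‖v x‖ ≤ m) →
      ‖nabla115 (((F.L : ℝ)⁻¹) ^ (K - n)) (bgOfCfg F K U₀)
          (fun q : Bond 3 (periodsT3 F K) => (toL2 F K c₀).symm (DL2 F n K c₀ U₀ (GprimeP F n K h c₀ cB a U₀ (RS F n K h c₀ cB U₀
            (GprimeP F n K h c₀ cB a U₀ (toL2S F K c₀ v))))) ((bondEquiv F K).symm q))‖
        ≤ (2 * (exists_curved_localGradient.choose * ((Real.sqrt 2 * (2 * (exists_curved_localGradient.choose * ((Real.sqrt 2 * (C₁ * C₃)) * (2 + 2 * Real.sqrt 2 * (4 * α * (3 + 2457 * norm_bgOfCfg_axialT_sub_le.choose)) + (24 * Real.sqrt 10 + 48) * (48 * α) ^ 2) + (Real.sqrt 2 * C₃)) + 2 * Real.sqrt 2 * (48 * α) * (Real.sqrt 2 * (C₁ * C₃))))) * (2 + 2 * Real.sqrt 2 * (4 * α * (3 + 2457 * norm_bgOfCfg_axialT_sub_le.choose)) + (24 * Real.sqrt 10 + 48) * (48 * α) ^ 2) + (Real.sqrt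 2 * (32 * α * (2 * (exists_curved_localGradient.choose * ((Real.sqrt 2 * (C₁ * C₃)) * (2 + 2 * Real.sqrt 2 * (4 * α * (3 + 2457 * norm_bgOfCfg_axialT_sub_le.choose)) + (24 * Real.sqrt 10 + 48) * (48 * α) ^ 2) + (Real.sqrt 2 * C₃)) + 2 * Real.sqrt 2 * (48 * α) * (Real.sqrt 2 * (C₁ * C₃)))) + ((4 * α * (C₁ * C₃)) + (4 * α * (C₁ * C₃))) + 0 + 0 + ((4 * α * (C₁ * C₃)) + CDg)))) + 2 * Real.sqrt 2 * (48 * α) * (Real.sqrt 2 * (2 * (exists_curved_localGradient.choose * ((Real.sqrt 2 * (C₁ * C₃)) * (2 + 2 * Real.sqrt 2 * (4 * α * (3 + 2457 * norm_bgOfCfg_axialT_sub_le.choose)) + (24 * Real.sqrt 10 + 48) * (48 * α) ^ 2) + (Real.sqrt 2 * C₃)) + 2 * Real.sqrt 2 * (48 * α) * (Real.sqrt 2 * (C₁ * C₃)))))))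
          * m := by
  intro v m hv
  have hm : 0 ≤ m := (norm_nonneg _).trans (hv (Classical.arbitrary _))
  have hCg0 : 0 ≤ exists_curved_localGradient.choose := exists_curved_localGradient.choose_spec.1
  obtain ⟨hC0, -⟩ := norm_bgOfCfg_axialT_sub_le.choose_spec
  -- the componentwise row, read per unit `m`
  have hcomp := norm_covGradT_DL2_chain_le_of_letters_allMembers F h c₀ cB a hα0 hα1 U₀ hreg ha hC₁ hC₃ hCDg hc1 hc3 hDg hsmall v hv
  set B : ℝ := (2 * (exists_curved_localGradient.choose * ((Real.sqrt 2 * (2 * (exists_curved_localGradient.choose * ((Real.sqrt 2 * (C₁ * C₃)) * (2 + 2 * Real.sqrt 2 * (4 * α * (3 + 2457 * norm_bgOfCfg_axialT_sub_le.choose)) + (24 * Real.sqrt 10 + 48) * (48 * α) ^ 2) + (Real.sqrt 2 * C₃)) + 2 * Real.sqrt 2 * (48 * α) * (Real.sqrt 2 * (C₁ * C₃))))) * (2 + 2 * Real.sqrt 2 * (4 * α * (3 + 2457 * norm_bgOfCfg_axialT_sub_le.choose)) + (24 * Real.sqrt 10 + 48) * (48 * α) ^ 2) + (Real.sqrt 2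 * (32 * α * (2 * (exists_curved_localGradient.choose * ((Real.sqrt 2 * (C₁ * C₃)) * (2 + 2 * Real.sqrt 2 * (4 * α * (3 + 2457 * norm_bgOfCfg_axialT_sub_le.choose)) + (24 * Real.sqrt 10 + 48) * (48 * α) ^ 2) + (Real.sqrt 2 * C₃)) + 2 * Real.sqrt 2 * (48 * α) * (Real.sqrt 2 * (C₁ * C₃)))) + ((4 * α * (C₁ * C₃)) + (4 * α * (C₁ * C₃))) + 0 + 0 + ((4 * α * (C₁ * C₃)) + CDg)))) + 2 * Real.sqrt 2 * (48 * α) * (Real.sqrt 2 * (2 * (exists_curved_localGradient.choose * ((Real.sqrt 2 * (C₁ * C₃)) * (2 + 2 * Real.sqrt 2 * (4 * α * (3 + 2457 * norm_bgOfCfg_axialT_sub_le.choose)) + (24 * Real.sqrt 10 + 48) * (48 * α) ^ 2) + (Real.sqrt 2 * C₃)) + 2 * Real.sqrt 2 * (48 * α) * (Real.sqrt 2 * (C₁ * C₃))))))) with hBdef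
  have hB : 0 ≤ B := by have := hα0.le; positivity
  have hBm : 0 ≤ B * m := mul_nonneg hB hm
  have hlin : 2 * (exists_curved_localGradient.choose * ((Real.sqrt 2 * (2 * (exists_curved_localGradient.choose * ((Real.sqrt 2 * (C₁ * (C₃ * m))) * (2 + 2 * Real.sqrt 2 * (4 * α * (3 + 2457 * norm_bgOfCfg_axialT_sub_le.choose)) + (24 * Real.sqrt 10 + 48) * (48 * α) ^ 2) + (Real.sqrt 2 * (C₃ * m))) + 2 * Real.sqrt 2 * (48 * α) * (Real.sqrt 2 * (C₁ * (C₃ * m)))))) * (2 + 2 * Real.sqrt 2 * (4 * α * (3 + 2457 * norm_bgOfCfg_axialT_sub_le.choose)) + (24 * Real.sqrt 10 + 48) * (48 * α) ^ 2) + (Real.sqrt 2 * (32 * α * (2 * (exists_curved_localGradient.choose * ((Real.sqrt 2 * (C₁ * (C₃ * m))) * (2 + 2 * Real.sqrt 2 * (4 * α * (3 + 2457 * norm_bgOfCfg_axialT_sub_le.choose)) + (24 * Real.sqrt 10 + 48) * (48 * α) ^ 2) + (Real.sqrt 2 * (C₃ * m))) + 2 * Real.sqrt 2 * (48 * α) *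 (Real.sqrt 2 * (C₁ * (C₃ * m))))) + ((4 * α * (C₁ * (C₃ * m))) + (4 * α * (C₁ * (C₃ * m)))) + 0 + 0 + ((4 * α * (C₁ * (C₃ * m))) + CDg * m)))) + 2 * Real.sqrt 2 * (48 * α) * (Real.sqrt 2 * (2 * (exists_curved_localGradient.choose * ((Real.sqrt 2 * (C₁ * (C₃ * m))) * (2 + 2 * Real.sqrt 2 * (4 * α * (3 + 2457 * norm_bgOfCfg_axialT_sub_le.choose)) + (24 * Real.sqrt 10 + 48) * (48 * α) ^ 2) + (Real.sqrt 2 * (C₃ * m))) + 2 * Real.sqrt 2 * (48 * α) * (Real.sqrt 2 * (C₁ * (C₃ * m)))))))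
      = B * m := by rw [hBdef]; ring
  refine (pi_norm_le_iff_of_nonneg hBm).2 fun qν => ?_
  obtain ⟨q, ν⟩ := qν
  obtain ⟨b, rfl⟩ := (bondEquiv F K).surjective q
  obtain ⟨x, μ⟩ := b
  rw [show (((F.L : ℝ)⁻¹) ^ (K - n)) = eta F n K from rfl, nabla115_bgOfCfg_eq_covGradT F c₀ U₀, ← hlin]
  exact hcomp μ ν x

end Chain

/-! ## §3 ★★★ The (H∇)-FAMILY ∃-package without the room -/

/-- ★★★ **THE (H∇) LETTER FOR EVERY MEMBER OF EVERY FAMILY — `αH′`, `BH` ∃-PACKAGED, L-ONLY, NO ROOM** (✓`hessRow_chain_family` with the no-wrap antecedent deleted).  For every `L > 1` there are a regularity scale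
`0 < αH′ L` (inside the `10¹²L³` window; `αH′ := min αH αP`, `αP` the (Dg) package's scale) and a constant `0 ≤ BH L` such that for every member
`i = (F, n < K)` with `F.L = L`, every background `U₀` with `RegPr F n K ρ U₀`, `ρ ≤ αH′ L`, the face's Lift antecedent, and every display coupling `0 ≤ a′`, the (∇1)-KNIT's chain-potential Hessian letter holds:
`∀ v m, (∀ x, ‖v x‖ ≤ m) → ‖∇^η_{(115)}(toL2⁻¹(D_{U₀}(G′ᴾ_{a′}(R_S(G′ᴾ_{a′}(toL2S v))))) ∘ bondEquiv⁻¹)‖ ≤ BH L · m`.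
PROOF: ✓`hessRow_chain_of_letters_allMembers` per member at `α := αH′ L` (`RegPr ρ → RegPr (αH′ L)` by ✓`regPr_mono`; `α ≤ 1` and `hsmall` by §1), its
letters (c1)∕(c3) ⟸ §2, (Dg) ⟸ ✓`gradRow_RS_GprimeP_allMembers_exists`; `BH` = HESS-T1's closed bound in `αH′ L, C₁ L, C₃ L, C_{Dg} L`
(assembled by unification), `0 ≤ BH L` by `positivity`.
[cite: Balaban1985Variational, (19) p.281, (115)–(117) pp.294–295, (138)–(139) p.299; Balaban1985BackgroundPropagators, (3.3) p.391, (3.20)–(3.25) p.394,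
Thm 3.1 (3.42)–(3.46) pp.397–398, (3.49) p.399, (3.114)–(3.122) pp.418–420, (3.138) p.423] -/
theorem hessRow_chain_family_allMembers (c₀ cB : ℕ → ℝ) [hc₀ : ∀ L : ℕ, Fact (0 < c₀ L)] [hcB : ∀ L : ℕ, Fact (0 < cB L)] :
    ∃ (αH BH : ℕ → ℝ), (∀ L : ℕ, 1 < L → 0 < αH L) ∧ (∀ L : ℕ, 1 < L → 10 ^ 12 * (L : ℝ) ^ 3 * αH L ≤ 1) ∧ (∀ L : ℕ, 1 < L → 0 ≤ BH L) ∧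
      ∀ (L : ℕ), 1 < L → ∀ (i : T3Thm1Carrier.Idx L) (U₀ : GaugeField (i.1.1.P i.1.2.2) 0 (Matrix.specialUnitaryGroup (Fin 2) ℂ)), ∀ ρ : ℝ, RegPr i.1.1 i.1.2.1 i.1.2.2 ρ U₀ →
        ρ ≤ αH L →
        (∀ cf : Site (i.1.1.P i.1.2.2) (i.1.2.2 - i.1.2.1) → Matrix (Fin 2) (Fin 2) ℂ,
        (∀ e' : PBond (i.1.1.P i.1.2.2) (i.1.2.2 - i.1.2.1), cf e'.src = ((emlIterU (i.1.2.2 - i.1.2.1) (bgUnits i.1.1 i.1.2.2 U₀) e' : (Matrix (Fin 2) (Fin 2) ℂ)ˣ) : Matrix (Fin 2) (Fin 2) ℂ) * cf e'.tgt *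
        (((emlIterU (i.1.2.2 - i.1.2.1) (bgUnits i.1.1 i.1.2.2 U₀) e')⁻¹ : (Matrix (Fin 2) (Fin 2) ℂ)ˣ) : Matrix (Fin 2) (Fin 2) ℂ)) →
        ∃ l₀ : Site (i.1.1.P i.1.2.2) 0 → Matrix (Fin 2) (Fin 2) ℂ,
        (∀ b' : PBond (i.1.1.P i.1.2.2) 0, l₀ b'.src = ((bgUnits i.1.1 i.1.2.2 U₀ b' : (Matrix (Fin 2) (Fin 2) ℂ)ˣ) : Matrix (Fin 2) (Fin 2) ℂ) * l₀ b'.tgt * (((bgUnits i.1.1 i.1.2.2 U₀ b')⁻¹ : (Matrix (Fin 2) (Fin 2) ℂ)ˣ) : Matrix (Fin 2) (Fin 2) ℂ)) ∧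
        ∀ y : Site (i.1.1.P i.1.2.2) (i.1.2.2 - i.1.2.1), l₀ (embIter (i.1.2.2 - i.1.2.1) y) = cf y) →
      ∀ a' : ℝ, 0 ≤ a' → ∀ (v : Site (i.1.1.P i.1.2.2) 0 → Matrix (Fin 2) (Fin 2) ℂ) (m : ℝ), (∀ x, ‖v x‖ ≤ m) →
        ‖nabla115 (((i.1.1.L : ℝ)⁻¹) ^ (i.1.2.2 - i.1.2.1)) (bgOfCfg i.1.1 i.1.2.2 U₀)
            (fun q : Bond 3 (periodsT3 i.1.1 i.1.2.2) => (toL2 i.1.1 i.1.2.2 (c₀ L)).symm (DL2 i.1.1 i.1.2.1 i.1.2.2 (c₀ L) U₀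
              (GprimeP i.1.1 i.1.2.1 i.1.2.2 i.2.2.le (c₀ L) (cB L) a' U₀ (RS i.1.1 i.1.2.1 i.1.2.2 i.2.2.le (c₀ L) (cB L) U₀
                (GprimeP i.1.1 i.1.2.1 i.1.2.2 i.2.2.le (c₀ L) (cB L) a' U₀ (toL2S i.1.1 i.1.2.2 (c₀ L) v))))) ((bondEquiv i.1.1 i.1.2.2).symm q))‖
          ≤ BH L * m := by
  have hCg0 : 0 ≤ exists_curved_localGradient.choose := exists_curved_localGradient.choose_spec.1
  obtain ⟨hC0, -⟩ := norm_bgOfCfg_axialT_sub_le.choose_spec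
  obtain ⟨C₁, C₃, hC₁, hC₃, hc13⟩ := hc1_hc3_sup_family c₀ cB
  obtain ⟨αP, CDg, hαP, hCDg, hDg⟩ := gradRow_RS_GprimeP_allMembers_exists c₀ cB
  -- the scale of this package: `αH′ := min αH αP`
  have hα0 : ∀ L : ℕ, 1 < L → 0 < min (min (1 / (10 ^ 12 * (L : ℝ) ^ 3)) (1 / (2 * ((exists_curved_localGradient.choose + 1) * (48 * (6 * Real.sqrt 2 * Real.sqrt 10 + 6 * Real.sqrt 2)))))) (αP L) := fun L hL => lt_min (alphaH_pos L hL) (hαP L hL)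
  have hwin : ∀ L : ℕ, 1 < L → 10 ^ 12 * (L : ℝ) ^ 3 * min (min (1 / (10 ^ 12 * (L : ℝ) ^ 3)) (1 / (2 * ((exists_curved_localGradient.choose + 1) * (48 * (6 * Real.sqrt 2 * Real.sqrt 10 + 6 * Real.sqrt 2)))))) (αP L) ≤ 1 ∧ min (min (1 / (10 ^ 12 * (L : ℝ) ^ 3)) (1 / (2 * ((exists_curved_localGradient.choose + 1) * (48 * (6 * Real.sqrt 2 * Real.sqrt 10 + 6 * Real.sqrt 2)))))) (αP L) ≤ 1 ∧
      exists_curved_localGradient.choose * ((48 * min (min (1 / (10 ^ 12 * (L : ℝ) ^ 3)) (1 / (2 * ((exists_curved_localGradient.choose + 1) * (48 * (6 * Real.sqrt 2 * Real.sqrt 10 + 6 * Real.sqrt 2)))))) (αP L)) * (6 * Real.sqrt 2 * Real.sqrt 10 + 6 * Real.sqrt 2)) ≤ 1 / 2 :=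
    fun L hL => alphaH_windows L hL (min_le_left _ _)
  -- the row FIRST (its proof assembles `BH` by unification), the sign SECOND (positivity on the assembled constant)
  have key : ∃ BH : ℕ → ℝ, (∀ (L : ℕ), 1 < L → ∀ (i : T3Thm1Carrier.Idx L) (U₀ : GaugeField (i.1.1.P i.1.2.2) 0 (Matrix.specialUnitaryGroup (Fin 2) ℂ)), ∀ ρ : ℝ, RegPr i.1.1 i.1.2.1 i.1.2.2 ρ U₀ →
        ρ ≤ min (min (1 / (10 ^ 12 * (L : ℝ) ^ 3)) (1 / (2 * ((exists_curved_localGradient.choose + 1) * (48 * (6 * Real.sqrt 2 * Real.sqrt 10 + 6 * Real.sqrt 2)))))) (αP L) →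
        (∀ cf : Site (i.1.1.P i.1.2.2) (i.1.2.2 - i.1.2.1) → Matrix (Fin 2) (Fin 2) ℂ,
        (∀ e' : PBond (i.1.1.P i.1.2.2) (i.1.2.2 - i.1.2.1), cf e'.src = ((emlIterU (i.1.2.2 - i.1.2.1) (bgUnits i.1.1 i.1.2.2 U₀) e' : (Matrix (Fin 2) (Fin 2) ℂ)ˣ) : Matrix (Fin 2) (Fin 2) ℂ) * cf e'.tgt *
        (((emlIterU (i.1.2.2 - i.1.2.1) (bgUnits i.1.1 i.1.2.2 U₀) e')⁻¹ : (Matrix (Fin 2) (Fin 2) ℂ)ˣ) : Matrix (Fin 2) (Fin 2) ℂ)) →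
        ∃ l₀ : Site (i.1.1.P i.1.2.2) 0 → Matrix (Fin 2) (Fin 2) ℂ,
        (∀ b' : PBond (i.1.1.P i.1.2.2) 0, l₀ b'.src = ((bgUnits i.1.1 i.1.2.2 U₀ b' : (Matrix (Fin 2) (Fin 2) ℂ)ˣ) : Matrix (Fin 2) (Fin 2) ℂ) * l₀ b'.tgt * (((bgUnits i.1.1 i.1.2.2 U₀ b')⁻¹ : (Matrix (Fin 2) (Fin 2) ℂ)ˣ) : Matrix (Fin 2) (Fin 2) ℂ)) ∧
        ∀ y : Site (i.1.1.P i.1.2.2) (i.1.2.2 - i.1.2.1), l₀ (embIter (i.1.2.2 - i.1.2.1) y) = cf y) →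
      ∀ a' : ℝ, 0 ≤ a' → ∀ (v : Site (i.1.1.P i.1.2.2) 0 → Matrix (Fin 2) (Fin 2) ℂ) (m : ℝ), (∀ x, ‖v x‖ ≤ m) →
        ‖nabla115 (((i.1.1.L : ℝ)⁻¹) ^ (i.1.2.2 - i.1.2.1)) (bgOfCfg i.1.1 i.1.2.2 U₀)
            (fun q : Bond 3 (periodsT3 i.1.1 i.1.2.2) => (toL2 i.1.1 i.1.2.2 (c₀ L)).symm (DL2 i.1.1 i.1.2.1 i.1.2.2 (c₀ L) U₀
              (GprimeP i.1.1 i.1.2.1 i.1.2.2 i.2.2.le (c₀ L) (cB L) a' U₀ (RS i.1.1 i.1.2.1 i.1.2.2 i.2.2.le (c₀ L) (cB L) U₀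
                (GprimeP i.1.1 i.1.2.1 i.1.2.2 i.2.2.le (c₀ L) (cB L) a' U₀ (toL2S i.1.1 i.1.2.2 (c₀ L) v))))) ((bondEquiv i.1.1 i.1.2.2).symm q))‖
          ≤ BH L * m) ∧ (∀ L : ℕ, 1 < L → 0 ≤ BH L) :=
    ⟨_, fun L hL i U₀ ρ hρ hρα hLift a' ha' v m hv =>
      hessRow_chain_of_letters_allMembers i.1.1 i.2.2.le (c₀ L) (cB L) a' (hα0 L hL) (hwin L hL).2.1 U₀ (regPr_mono i.1.1 hρα hρ) ha' (hC₁ L hL) (hC₃ L hL) (hCDg L hL)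
        (fun w m' hw x => (hc13 L hL i U₀ ρ hρ (hρα.trans (min_le_left _ _)) hLift a' ha' w m' hw).1 x)
        (fun w m' hw x => (hc13 L hL i U₀ ρ hρ (hρα.trans (min_le_left _ _)) hLift a' ha' w m' hw).2 x)
        (fun w m' hw b => hDg L hL i a' ha' U₀ (regPr_mono i.1.1 (hρα.trans (min_le_right _ _)) hρ) hLift w m' hw b)
        (hwin L hL).2.2 v m hv,
      fun L hL => by
        have := (hα0 L hL).le; have := hC₁ L hL; have := hC₃ L hL; have := hCDg L hL
        positivity⟩
  obtain ⟨BH, hrows, hBH⟩ := key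
  exact ⟨fun L => min (min (1 / (10 ^ 12 * (L : ℝ) ^ 3)) (1 / (2 * ((exists_curved_localGradient.choose + 1) * (48 * (6 * Real.sqrt 2 * Real.sqrt 10 + 6 * Real.sqrt 2)))))) (αP L), BH, hα0, fun L hL => (hwin L hL).1, hBH, hrows⟩

end Summit.QuantumFields.YangMills.Theorems.Prop7ChainPotentialHessianAllMembers

end
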